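import Summits.AtomisticToContinuum.Crystallization.Theorems.ChartedZeroExcessLayeredLatticeLiouvilleG2SeamR5Defs
/-!
# (g2) seam pilot, R = 5 fcc reference patch — K LANDING UNIT v3 (Chunk2: chunk theorems 4 and 5)

census-1 g52 (critic r1709 (C) / r1720 (B) / r1725 (A)): lens-2's ENERGY-ROUTE-96 seam constant S_E/ε² = ½ ΣΣ_{p,q ∈ seam} F_p F_q G∞(p,q) on the R = 5
fcc reference patch (b̄ = 9718/10000; bonds d ∈ {2,4,6} conventional = three LJ shells; F_p = Σ_{exterior bonds} ‖B‖, ‖B‖ = max(|13w⁷−7w⁴|, |w⁴−w⁷|), w = 1/r²;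
G∞ = min(G0, √2/(8π b̄³ √d)), integer Newton √; everything upper-rounded at 2⁻⁶⁰), certified by `decide +kernel` in CHUNKS joined by a proved split lemma,
final theorem ON THE OBJECT `pilot.sE`.  Module set: `ChartedZeroExcessLayeredLatticeLiouvilleG2SeamR5Defs` (this file's defs + structural lemmas; `import HarnessLib` only, for the gate's axiom audit) ← `ChartedZeroExcessLayeredLatticeLiouvilleG2SeamR5Chunk0..3` (two 71-row chunk theorems each,
≈ 150 s check-lane wall per file) ← `ChartedZeroExcessLayeredLatticeLiouvilleG2SeamR5Cert` (assembly: import-only + `seam_length`).  ELABORATOR-HYGIENE (r1720): no `show`/term-mode defeq against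
`build`-terms; chunk theorems on `totalChunk build.seam lo hi`; assembly by `rw` only; `decide +kernel` only on chunk theorems and closed numerals.
-/

namespace Summit.AtomisticToContinuum.Crystallization.Theorems.ChartedZeroExcessLayeredLatticeLiouville.G2SeamR5

/-- chunk 4: the partial double sum over seam rows [283, 354) (scale 2¹⁸⁰). -/
theorem chunk_4 : totalChunk build.seam 283 354 = 384948829391740747734085396448957368079322425084904696597470 := by decide +kernel

/-- chunk 5: the partial double sum over seam rows [354, 424) (scale 2¹⁸⁰). -/
theorem chunk_5 : totalChunk build.seam 354 424 = 354272445482126408592962815891881400404218991489077847728211 := by decide +kernel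

end Summit.AtomisticToContinuum.Crystallization.Theorems.ChartedZeroExcessLayeredLatticeLiouville.G2SeamR5
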